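import Summits.QuantumFields.YangMills.Theorems.BalabanUVNodesN18CombStepC1MainTerm
import HarnessLib

/-!
# N18 (β)-transport letters: THE SHARP GRADIENT OF THE COMB GENERATOR — `‖∇^ξ_{U_A} l‖` is `O(η·ℓ·(ℓ∕L)·α₁)`, no `1∕ξ`

[DAGN18W3-G5 INTENT-5, file (5a)] — count-neutral helper toward K3⁸ `stmt-QuantumFields-27366` (K3⁷ `stmt-QuantumFields-20544` aside; NOT claimed, NOT closed).
YM mass gap (Clay) NOT proved by any of this; R4 closes the conditional finite-𝕋⁴ rung `BalabanLadder.UV` only.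

WHY.  FILE 7's side conditions (p607192) multiply the comb generator's letters `δ₀ = |l|∕ξ`, `δ₁ = |∇^ξ_{U_A}l|∕ξ` and the transported potential's `a, a₁` by `4ξ`; with
the CRUDE `δ₁ = 2δ₀∕ξ` (3a) and `a₁ = 2a∕ξ` (FILE F) the products `4ξ·a·δ₁`, `4ξ·δ₀·a₁` lose their `ξ = η_j` and the radii law stops being summable along the
diagonal.  The true gradient of the comb generator is small WITHOUT `1∕ξ`: `ξ·∇^ξ_{U_A,μ} l(y) = iη·(Ū(U)(c)·m(c₊)·Ū(U)(c)⁻¹ − m(c₋))`, `c = ⟨y, μ⟩`, and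
`Ū(U)(c)·m(c₊)·Ū(U)(c)⁻¹ − m(c₋) = [base change, ≤ 69ℓ²ta] + [λ̄_Y(c₊) − λ̄_Y(c₋)]`, `Y = Ad(v₀)A′`, where the comb means of the SAME field at the two adjacent blocks
differ by the `Le_μ`-translate (g2 `combMean_translate_shift`), telescoping into `L` unit steps each `≤ η|∇^η_U A′| + 2t|A′|` ((4b) `norm_sub_shift_le`):
`‖λ̄_Y(c₊) − λ̄_Y(c₋)‖ ≤ ℓ·L·(η·a₁ + 2t·a)` — [Balaban1985Averaging] Prop. 3 p. 36 («the derivatives of the averages are averages of derivatives»).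

WHAT (ns `YMDAG.N18.TransportOfRecord`): `blockOf_add_nsmul_shift_mem_twoBlocks` (the `e_μ`-sweep of `B(y)` stays in `B(y) ∪ B(y+e_μ)`), `norm_combMean_shift_sub_le_of_steps`
(`‖λ̄_Y(y+e_μ) − λ̄_Y(y)‖ ≤ ℓ·L·D`), `norm_transport_conj_sub_combMean_le` (the base change `‖Ū(U)(c)m(c₊)Ū(U)(c)⁻¹ − λ̄_{Ad v₀ A′}(c₊)‖ ≤ 69ℓ²ta`, extracted from (4c)),
★ `norm_transport_comb_sub_comb_le`: `‖Ū(U)(c)·m(c₊)·Ū(U)(c)⁻¹ − m(c₋)‖ ≤ 69ℓ²·t·a + ℓ·L·(η·a₁ + 2t·a)` under two-block-local hypotheses.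

0 `def`, 0 `sorry`.  References: T. Bałaban, CMP **98** (1985) [Balaban1985Averaging] ((62)–(63) p.28, Prop. 3 (122)–(126) p.36, pp.24–25); CMP **109** (1987)
[Balaban1987RG1] ((0.4) p.253, (1.10)–(1.13) p.262).
-/

noncomputable section

open scoped BigOperators Matrix.Norms.L2Operator
open NormedSpace

namespace YMDAG.N18.TransportOfRecord

open Complex (I)
open Literature.MathematicalPhysics.QuantumFieldTheory.Balaban1983to89
open Literature.MathematicalPhysics.QuantumFieldTheory.Balaban1983to89.T4Continuum
open Literature.MathematicalPhysics.QuantumFieldTheory.Balaban1983to89.BlockAveraging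
open Literature.MathematicalPhysics.QuantumFieldTheory.Balaban1983to89.BlockAveragingEMLLinearised (combMean)
open Literature.MathematicalPhysics.QuantumFieldTheory.Balaban1983to89.B12RegularSpaces111 (expI gaugeU adJ plaq plaq_eq nabla)
open Literature.MathematicalPhysics.QuantumFieldTheory.Balaban1983to89.MatrixLog (mlog)
open Literature.MathematicalPhysics.QuantumFieldTheory.Balaban1983to89.B7Prop1Explicit renaming Site → LSite
open Literature.MathematicalPhysics.QuantumFieldTheory.Balaban1983to89.B7Prop1Explicit (e e_apply U1 mem_U1)
open Literature.MathematicalPhysics.QuantumFieldTheory.Balaban1983to89.B7Prop1Local (InBox)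
open Literature.MathematicalPhysics.QuantumFieldTheory.Balaban1983to89.B10Eq27TorusAxialLog (transl rel axialT axialT_self)
open Literature.MathematicalPhysics.QuantumFieldTheory.Balaban1983to89.T4TermwiseBCH (norm_units_conj_le)
open Literature.MathematicalPhysics.QuantumFieldTheory.Balaban1983to89.Node00.W1 (avgUnits)
open Summit.QuantumFields.YangMills.Theorems.Prop8Chart (emlAvgU_congr₂ norm_emlAvgU_sub_one_sub_linAvg_le)
open YMDAG.N18.AvgPotential (combMean_congr_block combMean_sub' combMean_translate_shift)
open YMDAG.N18.BoxStokes (blockOf_transl_emb)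

variable {P : Params} {j : ℕ}

/-! ## §1 The `e_μ`-sweep of a block and the telescoped comb means -/

section Sweep

/-- **The `e_μ`-sweep of `B(y)` stays in the two blocks**: `blockOf x = y ⇒ blockOf (x + i·e_μ) ∈ {y, y+e_μ}` for `i ≤ L` (`j + 2 ≤ m + K`). [cite: Balaban1987RG1, (0.3)-(0.4) pp.252-253] -/
theorem blockOf_add_nsmul_shift_mem_twoBlocks (hj : j + 1 ≤ P.m + P.K) (hj2 : j + 2 ≤ P.m + P.K) (y : Site P (j + 1)) (μ : Fin P.d) {x : Site P j}
    (hx : blockOf x = y) {i : ℕ} (hi : i ≤ P.L) :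
    blockOf (x + i • (0 : Site P j).shift μ) = y ∨ blockOf (x + i • (0 : Site P j).shift μ) = y.shift μ := by
  have hz := inBox_rel_of_twoBlock hj hj2 (⟨y, μ⟩ : PBond P (j + 1)) (x := x) (Or.inl hx)
  obtain ⟨r, hr⟩ : ∃ r : Fin P.d → Fin P.L, x = Site.blockSite (blockOf x) r := ⟨_, BlockAveragingSectionQsstar.eq_blockSite_blockEquiv hj x⟩
  rw [hx] at hr
  have hrel : rel (emb y) x = off r := by rw [hr, rel_emb_blockSite hj]
  have hx' : x + i • (0 : Site P j).shift μ = transl (emb y) (rel (emb y) x + (i : ℤ) • e μ) := by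
    rw [add_nsmul_zero_shift_eq_transl, B10Eq27TorusAxialLog.transl_add, B10Eq27TorusAxialLog.transl_rel]
  rw [hx']
  refine blockOf_transl_emb hj ⟨y, μ⟩ fun κ => ?_
  rw [hrel, Pi.add_apply, Pi.smul_apply, e_apply, smul_eq_mul]
  have hb := off_bounds r κ
  have hi' : (i : ℤ) ≤ P.L := by exact_mod_cast hi
  dsimp only
  by_cases hκ : κ = μ
  · subst hκ; simp only [if_true, mul_one]; constructor <;> omega
  · rw [if_neg hκ, if_neg (Ne.symm hκ)]; simp only [mul_zero, add_zero, zero_add]; constructor <;> omega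

variable {n : Type*} [Fintype n] [DecidableEq n]

/-- **Comb means of one field at adjacent blocks differ by the telescoped sweep**: `λ̄_Y(y + e_μ) − λ̄_Y(y) = λ̄_{Y∘τ_{Le_μ} − Y}(y)` (g2 `combMean_translate_shift`), hence
`‖·‖ ≤ ℓ·(L·D)` if along the `e_μ`-sweep of every bond of `B(y)` the unit differences of `Y` are `≤ D`. [cite: Balaban1985Averaging, (62)-(63) p.28, Prop. 3 p.36] -/
theorem norm_combMean_shift_sub_le_of_steps (hj : j + 1 ≤ P.m + P.K) (Y : PBond P j → Matrix n n ℂ) (y : Site P (j + 1)) (μ : Fin P.d) {D : ℝ} (hD0 : 0 ≤ D)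
    (hD : ∀ b : PBond P j, blockOf b.src = y → blockOf b.tgt = y →
      ∀ i < P.L, ‖Y ((b.translate (i • (0 : Site P j).shift μ)).translate ((0 : Site P j).shift μ)) - Y (b.translate (i • (0 : Site P j).shift μ))‖ ≤ D) :
    ‖combMean Y (y.shift μ) - combMean Y y‖ ≤ (((P.d + 2) * P.L : ℕ) : ℝ) * ((P.L : ℝ) * D) := by
  classical
  rw [← combMean_translate_shift Y y μ, ← combMean_sub']
  let Z : PBond P j → Matrix n n ℂ := fun b => if blockOf b.src = y ∧ blockOf b.tgt = y then Y (b.translate (P.L • (0 : Site P j).shift μ)) - Y b else 0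
  have hZ : ∀ b, ‖Z b‖ ≤ (P.L : ℝ) * D := fun b => by
    by_cases hb : blockOf b.src = y ∧ blockOf b.tgt = y
    · simp only [Z, if_pos hb]; exact norm_sub_translate_nsmul_le Y _ b P.L (hD b hb.1 hb.2)
    · simp only [Z, if_neg hb, norm_zero]; positivity
  have hcongr : combMean (fun b => Y (b.translate (P.L • (0 : Site P j).shift μ)) - Y b) y = combMean Z y :=
    combMean_congr_block hj y fun b h1 h2 => by simp only [Z, if_pos (And.intro h1 h2)]
  rw [hcongr]
  exact norm_combMean_le_of_bound Z (by positivity) hZ y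

end Sweep

/-! ## §2 The base change, and the sharp letter -/

section Sharp

variable {n : Type*} [Fintype n] [DecidableEq n] [Nonempty n]

/-- **The base change of the transported comb** (the estimate inside (4c), extracted): under the two-block-local hypotheses at `c` (`U ∈ U1`, plaquettes `≤ α`,
`((d+2)L∕2)α ≤ t`, `136ℓt ≤ 1`, `|A′| ≤ a` on the two blocks), with `v₀ = axialT U (emb c₋)`, `m(z) = λ̄_{Ad(axialT U (emb z))A′}(z)`:
`‖Ū(U)(c)·m(c₊)·Ū(U)(c)⁻¹ − λ̄_{Ad(v₀)A′}(c₊)‖ ≤ 69ℓ²·t·a` ((2a) ★ + `Ū(U)(c) = Ū(U^{v₀})(c)·v₀(emb c₊)`, `‖Ū(U^{v₀})(c) − 1‖ ≤ 17ℓt`).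
[cite: Balaban1985Averaging, (8)-(11) pp.18-19, pp.24-25, (62)-(63) p.28, Prop. 3 (122)-(125) p.36] -/
theorem norm_transport_conj_sub_combMean_le (hj : j + 1 ≤ P.m + P.K) (hj2 : j + 2 ≤ P.m + P.K) (c : PBond P (j + 1))
    {U : GaugeField P j (Matrix n n ℂ)ˣ} {A : PBond P j → Matrix n n ℂ} {a α t : ℝ} (ha0 : 0 ≤ a) (hα : 0 ≤ α)
    (hA : ∀ b : PBond P j, (blockOf b.src = c.src ∨ blockOf b.src = c.tgt) → (blockOf b.tgt = c.src ∨ blockOf b.tgt = c.tgt) → ‖A b‖ ≤ a)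
    (hU1 : ∀ b : PBond P j, (blockOf b.src = c.src ∨ blockOf b.src = c.tgt) → (blockOf b.tgt = c.src ∨ blockOf b.tgt = c.tgt) →
      U b ∈ U1 (Matrix n n ℂ))
    (hplaq : ∀ p : Plaq P j, (blockOf p.src = c.src ∨ blockOf p.src = c.tgt) →
      (blockOf (p.src.shift p.μ) = c.src ∨ blockOf (p.src.shift p.μ) = c.tgt) →
      (blockOf (p.src.shift p.ν) = c.src ∨ blockOf (p.src.shift p.ν) = c.tgt) →
      (blockOf ((p.src.shift p.μ).shift p.ν) = c.src ∨ blockOf ((p.src.shift p.μ).shift p.ν) = c.tgt) →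
      ‖((plaq U p : (Matrix n n ℂ)ˣ) : Matrix n n ℂ) - 1‖ ≤ α)
    (hRt : ((((P.d + 2) * P.L : ℕ) : ℝ) / 2) * α ≤ t) (hℓt : 136 * (((P.d + 2) * P.L : ℕ) : ℝ) * t ≤ 1) :
    ‖((avgUnits U c : (Matrix n n ℂ)ˣ) : Matrix n n ℂ) * combMean (adJ (axialT U (emb c.tgt)) A) c.tgt * (((avgUnits U c)⁻¹ : (Matrix n n ℂ)ˣ) : Matrix n n ℂ) -
        combMean (adJ (axialT U (emb c.src)) A) c.tgt‖ ≤ 69 * (((P.d + 2) * P.L : ℕ) : ℝ) ^ 2 * t * a := by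
  classical
  have ht0 : 0 ≤ t := le_trans (by positivity) hRt
  set ℓ : ℝ := (((P.d + 2) * P.L : ℕ) : ℝ) with hℓdef
  have hℓ0 : 0 ≤ ℓ := Nat.cast_nonneg _
  -- the cut-off factor and the gauges
  let χ : PBond P j → Prop := fun b => (blockOf b.src = c.src ∨ blockOf b.src = c.tgt) ∧ (blockOf b.tgt = c.src ∨ blockOf b.tgt = c.tgt)
  let U' : GaugeField P j (Matrix n n ℂ)ˣ := fun b => if χ b then U b else 1
  have hU'U : ∀ b : PBond P j, (blockOf b.src = c.src ∨ blockOf b.src = c.tgt) → (blockOf b.tgt = c.src ∨ blockOf b.tgt = c.tgt) → U' b = U b :=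
    fun b h1 h2 => by simp only [U', χ, if_pos (And.intro h1 h2)]
  have hUU' : ∀ b : PBond P j, (blockOf b.src = c.src ∨ blockOf b.src = c.tgt) → (blockOf b.tgt = c.src ∨ blockOf b.tgt = c.tgt) → U b = U' b :=
    fun b h1 h2 => (hU'U b h1 h2).symm
  have hU'1 : ∀ b, U' b ∈ U1 (Matrix n n ℂ) := fun b => by
    by_cases hb : χ b
    · simp only [U', if_pos hb]; exact hU1 b hb.1 hb.2
    · simp only [U', if_neg hb]; exact (U1 _).one_mem
  have hplaq' : ∀ p : Plaq P j, (blockOf p.src = c.src ∨ blockOf p.src = c.tgt) →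
      (blockOf (p.src.shift p.μ) = c.src ∨ blockOf (p.src.shift p.μ) = c.tgt) →
      (blockOf (p.src.shift p.ν) = c.src ∨ blockOf (p.src.shift p.ν) = c.tgt) →
      (blockOf ((p.src.shift p.μ).shift p.ν) = c.src ∨ blockOf ((p.src.shift p.μ).shift p.ν) = c.tgt) →
      ‖((plaq U' p : (Matrix n n ℂ)ˣ) : Matrix n n ℂ) - 1‖ ≤ α := fun p c1 c2 c3 c4 => by
    have hpe : plaq U' p = plaq U p := by
      rw [plaq_eq, plaq_eq, hU'U ⟨p.src, p.μ⟩ c1 c2, hU'U ⟨p.src.shift p.μ, p.ν⟩ c2 c4, hU'U ⟨p.src, p.ν⟩ c1 c3,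
        hU'U ⟨p.src.shift p.ν, p.μ⟩ c3 (by rw [PBond.tgt, Site.shift_comm]; exact c4)]
    rw [hpe]; exact hplaq p c1 c2 c3 c4
  set v : Site P j → (Matrix n n ℂ)ˣ := axialT U' (emb c.src) with hvdef
  have hv1 : ∀ x, v x ∈ U1 (Matrix n n ℂ) := fun x => axialT_mem_U1 hU'1 _ x
  have hv0 : v (emb c.src) = 1 := axialT_self U' (emb c.src)
  have hvU : ∀ x : Site P j, (blockOf x = c.src ∨ blockOf x = c.tgt) → v x = axialT U (emb c.src) x := fun x hx =>
    axialT_congr_of_twoBlock hj hj2 c hU'U hx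
  have h2 := norm_combMean_sub_conj_combMean_le hj hj2 c ha0 hα (fun b h1 h2 => hA b (Or.inr h1) (Or.inr h2)) hU1 hplaq hRt
  set g : (Matrix n n ℂ)ˣ := axialT U (emb c.src) (emb c.tgt) with hg
  set mt : Matrix n n ℂ := combMean (adJ (axialT U (emb c.tgt)) A) c.tgt with hmt
  set lt : Matrix n n ℂ := combMean (adJ (axialT U (emb c.src)) A) c.tgt with hlt
  set UA : (Matrix n n ℂ)ˣ := avgUnits U c with hUA
  have hV₀ : ∀ b : PBond P j, (blockOf b.src = c.src ∨ blockOf b.src = c.tgt) → (blockOf b.tgt = c.src ∨ blockOf b.tgt = c.tgt) →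
      ‖((gaugeU v U' b : (Matrix n n ℂ)ˣ) : Matrix n n ℂ) - 1‖ ≤ t := fun b h1 h2 =>
    (norm_gaugeU_axialT_sub_one_le_of_twoBlock hj hj2 hU'1 c hα hplaq' b h1 h2).trans hRt
  have h17 := (norm_emlAvgU_sub_one_sub_linAvg_le hj (S := gaugeU v U') c ht0 (by nlinarith only [hℓt, mul_nonneg hℓ0 ht0]) hV₀).2
  set E : (Matrix n n ℂ)ˣ := avgUnits (gaugeU v U') c with hE
  change ‖(E : Matrix n n ℂ) - 1‖ ≤ 17 * ℓ * t at h17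
  have hUA_eq : UA = E * g := by
    have hcov := avgUnits_gaugeU v U'
    have hloc : avgUnits U' c = avgUnits U c := emlAvgU_congr₂ hj c hU'U
    have hE' : E = v (emb c.src) * avgUnits U c * (v (emb c.tgt))⁻¹ := by
      rw [hE, hcov]; simp only [gaugeU, hloc]
    rw [hE', hv0, one_mul, hUA, hg, ← hvU _ (Or.inr (Site.blockOf_emb hj c.tgt)), inv_mul_cancel_right]
  have hmt' : ‖mt‖ ≤ ℓ * a := by
    let Yb : PBond P j → Matrix n n ℂ := fun b => if blockOf b.src = c.tgt ∧ blockOf b.tgt = c.tgt then adJ (axialT U (emb c.tgt)) A b else 0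
    have hY : ∀ b, ‖Yb b‖ ≤ a := fun b => by
      by_cases hb : blockOf b.src = c.tgt ∧ blockOf b.tgt = c.tgt
      · simp only [Yb, if_pos hb, adJ]
        have hu1 : axialT U (emb c.tgt) b.src ∈ U1 (Matrix n n ℂ) := by
          rw [axialT_congr_of_block hj (fun b' h1 h2 => (hU'U b' (Or.inr h1) (Or.inr h2)).symm) hb.1]; exact axialT_mem_U1 hU'1 _ _
        exact (norm_units_conj_le hu1 _).trans (hA b (Or.inr hb.1) (Or.inr hb.2))
      · simp only [Yb, if_neg hb, norm_zero]; exact ha0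
    have hmY : mt = combMean Yb c.tgt := combMean_congr_block hj c.tgt fun b h1 h2 => by simp only [Yb, if_pos (And.intro h1 h2)]
    rw [hmY]; exact norm_combMean_le_of_bound Yb ha0 hY c.tgt
  have hg1 : g ∈ U1 (Matrix n n ℂ) := by rw [hg, ← hvU _ (Or.inr (Site.blockOf_emb hj c.tgt))]; exact hv1 _
  have hY' : ‖(g : Matrix n n ℂ) * mt * ((g⁻¹ : (Matrix n n ℂ)ˣ) : Matrix n n ℂ)‖ ≤ ℓ * a := (norm_units_conj_le hg1 _).trans hmt'
  have hconjE : ‖(UA : Matrix n n ℂ) * mt * ((UA⁻¹ : (Matrix n n ℂ)ˣ) : Matrix n n ℂ) - (g : Matrix n n ℂ) * mt * ((g⁻¹ : (Matrix n n ℂ)ˣ) : Matrix n n ℂ)‖ ≤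
      4 * (17 * ℓ * t) * (ℓ * a) := by
    have hid : (UA : Matrix n n ℂ) * mt * ((UA⁻¹ : (Matrix n n ℂ)ˣ) : Matrix n n ℂ) =
        (E : Matrix n n ℂ) * ((g : Matrix n n ℂ) * mt * ((g⁻¹ : (Matrix n n ℂ)ˣ) : Matrix n n ℂ)) * ((E⁻¹ : (Matrix n n ℂ)ˣ) : Matrix n n ℂ) := by
      rw [hUA_eq, mul_inv_rev, Units.val_mul, Units.val_mul]; noncomm_ring
    rw [hid]
    exact (norm_conj_sub_le_of_near_one h17 (by nlinarith only [hℓt, mul_nonneg hℓ0 ht0]) _).trans (mul_le_mul_of_nonneg_left hY' (by positivity))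
  have h2' : ‖lt - (g : Matrix n n ℂ) * mt * ((g⁻¹ : (Matrix n n ℂ)ˣ) : Matrix n n ℂ)‖ ≤ ℓ ^ 2 * t * a := h2
  have hsplit : (UA : Matrix n n ℂ) * mt * ((UA⁻¹ : (Matrix n n ℂ)ˣ) : Matrix n n ℂ) - lt =
      ((UA : Matrix n n ℂ) * mt * ((UA⁻¹ : (Matrix n n ℂ)ˣ) : Matrix n n ℂ) - (g : Matrix n n ℂ) * mt * ((g⁻¹ : (Matrix n n ℂ)ˣ) : Matrix n n ℂ)) -
        (lt - (g : Matrix n n ℂ) * mt * ((g⁻¹ : (Matrix n n ℂ)ˣ) : Matrix n n ℂ)) := by abel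
  rw [hsplit]
  refine (norm_sub_le _ _).trans ?_
  rw [hℓdef] at hconjE h2' ⊢
  nlinarith only [hconjE, h2', mul_nonneg (mul_nonneg hℓ0 ht0) ha0, hℓdef]

/-- ★ **THE SHARP LETTER FOR THE COMB GENERATOR's GRADIENT.**  Under the two-block-local hypotheses at `c = ⟨y, μ⟩` (`U ∈ U1`, plaquettes `≤ α`, `((d+2)L∕2)α ≤ t`,
`136ℓt ≤ 1`, `|A′| ≤ a` on the two blocks) and `|∇^η_{U,μ}A′_κ(z)| ≤ a₁` whenever `z, z+e_μ, z+e_κ, z+e_μ+e_κ` lie in the two blocks: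
`‖Ū(U)(c)·m(c₊)·Ū(U)(c)⁻¹ − m(c₋)‖ ≤ 69ℓ²·t·a + ℓ·L·(η·a₁ + 2t·a)`, `m(z) = λ̄_{Ad(axialT U (emb z))A′}(z)` — so `ξ‖∇^ξ_{Ū(U),μ}(iη·m)(y)‖` is this times `η`:
NO `1∕ξ` (compare (3a)'s crude `2ηℓa`: the same order `ηℓ·a` but now with the factor `(ℓ∕L)·(η a₁∕a + t)`-type smallness replaced... precisely `η·[69ℓ²ta + ℓL(ηa₁ + 2ta)]`).
[cite: Balaban1985Averaging, (62)-(63) p.28, Prop. 3 (122)-(126) p.36, pp.24-25; Balaban1987RG1, (0.4) p.253, (1.10)-(1.13) p.262] -/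
theorem norm_transport_comb_sub_comb_le (hj : j + 1 ≤ P.m + P.K) (hj2 : j + 2 ≤ P.m + P.K) (y : Site P (j + 1)) (μ : Fin P.d)
    {U : GaugeField P j (Matrix n n ℂ)ˣ} {A : PBond P j → Matrix n n ℂ} {η a a₁ α t : ℝ} (hη : 0 < η) (ha0 : 0 ≤ a) (ha1 : 0 ≤ a₁) (hα : 0 ≤ α)
    (hA : ∀ b : PBond P j, (blockOf b.src = y ∨ blockOf b.src = y.shift μ) → (blockOf b.tgt = y ∨ blockOf b.tgt = y.shift μ) → ‖A b‖ ≤ a)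
    (hU1 : ∀ b : PBond P j, (blockOf b.src = y ∨ blockOf b.src = y.shift μ) → (blockOf b.tgt = y ∨ blockOf b.tgt = y.shift μ) → U b ∈ U1 (Matrix n n ℂ))
    (hplaq : ∀ p : Plaq P j, (blockOf p.src = y ∨ blockOf p.src = y.shift μ) →
      (blockOf (p.src.shift p.μ) = y ∨ blockOf (p.src.shift p.μ) = y.shift μ) →
      (blockOf (p.src.shift p.ν) = y ∨ blockOf (p.src.shift p.ν) = y.shift μ) →
      (blockOf ((p.src.shift p.μ).shift p.ν) = y ∨ blockOf ((p.src.shift p.μ).shift p.ν) = y.shift μ) →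
      ‖((plaq U p : (Matrix n n ℂ)ˣ) : Matrix n n ℂ) - 1‖ ≤ α)
    (hA1 : ∀ (z : Site P j) (κ : Fin P.d), (blockOf z = y ∨ blockOf z = y.shift μ) → (blockOf (z.shift μ) = y ∨ blockOf (z.shift μ) = y.shift μ) →
      (blockOf (z.shift κ) = y ∨ blockOf (z.shift κ) = y.shift μ) → (blockOf ((z.shift μ).shift κ) = y ∨ blockOf ((z.shift μ).shift κ) = y.shift μ) →
      ‖nabla η U μ (fun w => A ⟨w, κ⟩) z‖ ≤ a₁)
    (hRt : ((((P.d + 2) * P.L : ℕ) : ℝ) / 2) * α ≤ t) (hℓt : 136 * (((P.d + 2) * P.L : ℕ) : ℝ) * t ≤ 1) :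
    ‖((avgUnits U ⟨y, μ⟩ : (Matrix n n ℂ)ˣ) : Matrix n n ℂ) * combMean (adJ (axialT U (emb (y.shift μ))) A) (y.shift μ) *
          (((avgUnits U ⟨y, μ⟩)⁻¹ : (Matrix n n ℂ)ˣ) : Matrix n n ℂ) - combMean (adJ (axialT U (emb y)) A) y‖ ≤
      69 * (((P.d + 2) * P.L : ℕ) : ℝ) ^ 2 * t * a + (((P.d + 2) * P.L : ℕ) : ℝ) * ((P.L : ℝ) * (η * a₁ + 2 * t * a)) := by
  classical
  have ht0 : 0 ≤ t := le_trans (by positivity) hRt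
  -- base change (c₊) + telescoped comb means of `Y = Ad(v₀)A′`
  have hBC := norm_transport_conj_sub_combMean_le hj hj2 (⟨y, μ⟩ : PBond P (j + 1)) (U := U) (A := A) ha0 hα hA hU1 hplaq hRt hℓt
  -- the pair (two-block) cut-off: `v₀` on the blocks, `U^{v₀}` within `t`
  let χ : PBond P j → Prop := fun b => (blockOf b.src = y ∨ blockOf b.src = y.shift μ) ∧ (blockOf b.tgt = y ∨ blockOf b.tgt = y.shift μ)
  let U' : GaugeField P j (Matrix n n ℂ)ˣ := fun b => if χ b then U b else 1
  have hU'U : ∀ b : PBond P j, (blockOf b.src = y ∨ blockOf b.src = y.shift μ) → (blockOf b.tgt = y ∨ blockOf b.tgt = y.shift μ) → U' b = U b :=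
    fun b h1 h2 => by simp only [U', χ, if_pos (And.intro h1 h2)]
  have hU'1 : ∀ b, U' b ∈ U1 (Matrix n n ℂ) := fun b => by
    by_cases hb : χ b
    · simp only [U', if_pos hb]; exact hU1 b hb.1 hb.2
    · simp only [U', if_neg hb]; exact (U1 _).one_mem
  have hplaq' : ∀ p : Plaq P j, (blockOf p.src = y ∨ blockOf p.src = y.shift μ) →
      (blockOf (p.src.shift p.μ) = y ∨ blockOf (p.src.shift p.μ) = y.shift μ) →
      (blockOf (p.src.shift p.ν) = y ∨ blockOf (p.src.shift p.ν) = y.shift μ) →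
      (blockOf ((p.src.shift p.μ).shift p.ν) = y ∨ blockOf ((p.src.shift p.μ).shift p.ν) = y.shift μ) →
      ‖((plaq U' p : (Matrix n n ℂ)ˣ) : Matrix n n ℂ) - 1‖ ≤ α := fun p c1 c2 c3 c4 => by
    have hpe : plaq U' p = plaq U p := by
      rw [plaq_eq, plaq_eq, hU'U ⟨p.src, p.μ⟩ c1 c2, hU'U ⟨p.src.shift p.μ, p.ν⟩ c2 c4, hU'U ⟨p.src, p.ν⟩ c1 c3,
        hU'U ⟨p.src.shift p.ν, p.μ⟩ c3 (by rw [PBond.tgt, Site.shift_comm]; exact c4)]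
    rw [hpe]; exact hplaq p c1 c2 c3 c4
  have hvv' : ∀ x : Site P j, (blockOf x = y ∨ blockOf x = y.shift μ) → axialT U (emb y) x = axialT U' (emb y) x := fun x hx =>
    (axialT_congr_of_twoBlock hj hj2 (⟨y, μ⟩ : PBond P (j + 1)) hU'U hx).symm
  have hv1 : ∀ x : Site P j, (blockOf x = y ∨ blockOf x = y.shift μ) → axialT U (emb y) x ∈ U1 (Matrix n n ℂ) := fun x hx => by
    rw [hvv' x hx]; exact axialT_mem_U1 hU'1 _ x
  have hV₀ : ∀ b : PBond P j, (blockOf b.src = y ∨ blockOf b.src = y.shift μ) → (blockOf b.tgt = y ∨ blockOf b.tgt = y.shift μ) →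
      gaugeU (axialT U (emb y)) U b ∈ U1 (Matrix n n ℂ) ∧ ‖((gaugeU (axialT U (emb y)) U b : (Matrix n n ℂ)ˣ) : Matrix n n ℂ) - 1‖ ≤ t := fun b h1 h2 => by
    have heq : gaugeU (axialT U (emb y)) U b = gaugeU (axialT U' (emb y)) U' b := by
      simp only [gaugeU, hvv' b.src h1, hvv' b.tgt h2, hU'U b h1 h2]
    rw [heq]
    refine ⟨(U1 _).mul_mem ((U1 _).mul_mem (axialT_mem_U1 hU'1 _ _) (hU'1 b)) ((U1 _).inv_mem (axialT_mem_U1 hU'1 _ _)), ?_⟩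
    exact (norm_gaugeU_axialT_sub_one_le_of_twoBlock hj hj2 hU'1 ⟨y, μ⟩ hα hplaq' b h1 h2).trans hRt
  -- the telescoped comb means
  have hcomb : ‖combMean (adJ (axialT U (emb y)) A) (y.shift μ) - combMean (adJ (axialT U (emb y)) A) y‖ ≤
      (((P.d + 2) * P.L : ℕ) : ℝ) * ((P.L : ℝ) * (η * a₁ + 2 * t * a)) := by
    refine norm_combMean_shift_sub_le_of_steps hj _ y μ (by positivity) fun b h1 h2 i hi => ?_
    set z : Site P j := b.src + i • (0 : Site P j).shift μ with hz
    have hbi : b.translate (i • (0 : Site P j).shift μ) = ⟨z, b.dir⟩ := rfl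
    have hbi' : (b.translate (i • (0 : Site P j).shift μ)).translate ((0 : Site P j).shift μ) = ⟨z.shift μ, b.dir⟩ := by
      rw [PBond.translate_translate]; show (⟨b.src + (i • (0 : Site P j).shift μ + (0 : Site P j).shift μ), b.dir⟩ : PBond P j) = _
      rw [← add_assoc, ← hz, Site.add_zero_shift]
    rw [hbi', hbi]
    have hzmem := blockOf_add_nsmul_shift_mem_twoBlocks hj hj2 y μ h1 hi.le
    have hzμ : blockOf (z.shift μ) = y ∨ blockOf (z.shift μ) = y.shift μ := by
      have h := blockOf_add_nsmul_shift_mem_twoBlocks hj hj2 y μ h1 (Nat.succ_le_of_lt hi)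
      rwa [succ_nsmul, ← add_assoc, ← hz, Site.add_zero_shift] at h
    have hzκ : blockOf (z.shift b.dir) = y ∨ blockOf (z.shift b.dir) = y.shift μ := by
      have h := blockOf_add_nsmul_shift_mem_twoBlocks hj hj2 y μ (x := b.tgt) h2 hi.le
      have heq : b.tgt + i • (0 : Site P j).shift μ = z.shift b.dir := by
        rw [hz, PBond.tgt, ← Site.add_zero_shift b.src b.dir, ← Site.add_zero_shift (b.src + i • (0 : Site P j).shift μ) b.dir]
        abel
      rwa [heq] at h
    have hzμκ : blockOf ((z.shift μ).shift b.dir) = y ∨ blockOf ((z.shift μ).shift b.dir) = y.shift μ := by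
      have h := blockOf_add_nsmul_shift_mem_twoBlocks hj hj2 y μ (x := b.tgt) h2 (Nat.succ_le_of_lt hi)
      have heq : b.tgt + (i + 1) • (0 : Site P j).shift μ = (z.shift μ).shift b.dir := by
        rw [succ_nsmul, hz, PBond.tgt, ← Site.add_zero_shift b.src b.dir,
          ← Site.add_zero_shift ((b.src + i • (0 : Site P j).shift μ).shift μ) b.dir, ← Site.add_zero_shift (b.src + i • (0 : Site P j).shift μ) μ]
        abel
      rwa [heq] at h
    obtain ⟨hVU1, hVt⟩ := hV₀ ⟨z, μ⟩ hzmem hzμ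
    have hstep := norm_sub_shift_le hη (axialT U (emb y)) U A z μ b.dir (hv1 z hzmem) (hv1 _ hzμ) hVU1
    refine hstep.trans ?_
    have h1' := hA1 z b.dir hzmem hzμ hzκ hzμκ
    have h2' := hA ⟨z.shift μ, b.dir⟩ hzμ hzμκ
    have : 0 ≤ ‖((gaugeU (axialT U (emb y)) U ⟨z, μ⟩ : (Matrix n n ℂ)ˣ) : Matrix n n ℂ) - 1‖ := norm_nonneg _
    nlinarith only [mul_le_mul hVt h2' (norm_nonneg _) ht0, norm_nonneg (nabla η U μ (fun w => A ⟨w, b.dir⟩) z), h1', h2', this, hη, ht0]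
  have hsplit : ((avgUnits U ⟨y, μ⟩ : (Matrix n n ℂ)ˣ) : Matrix n n ℂ) * combMean (adJ (axialT U (emb (y.shift μ))) A) (y.shift μ) *
        (((avgUnits U ⟨y, μ⟩)⁻¹ : (Matrix n n ℂ)ˣ) : Matrix n n ℂ) - combMean (adJ (axialT U (emb y)) A) y =
      (((avgUnits U ⟨y, μ⟩ : (Matrix n n ℂ)ˣ) : Matrix n n ℂ) * combMean (adJ (axialT U (emb (y.shift μ))) A) (y.shift μ) *
          (((avgUnits U ⟨y, μ⟩)⁻¹ : (Matrix n n ℂ)ˣ) : Matrix n n ℂ) - combMean (adJ (axialT U (emb y)) A) (y.shift μ)) +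
        (combMean (adJ (axialT U (emb y)) A) (y.shift μ) - combMean (adJ (axialT U (emb y)) A) y) := by abel
  rw [hsplit]
  exact (norm_add_le _ _).trans (add_le_add hBC hcomb)

end Sharp

end YMDAG.N18.TransportOfRecord

end
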